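import Literature.AlgebraicGeometry.AbelianSchemes.AbelianSchemeQuotientDescentOfUnitFibrewise
import Literature.AlgebraicGeometry.AbelianSchemes.PoincareStabilizerDualKernel
import Literature.AlgebraicGeometry.AbelianSchemes.PoincareSheafMulNKernel
import Literature.AlgebraicGeometry.AbelianSchemes.AbelianSchemeQuotientPoincarePullback
import Literature.AlgebraicGeometry.AbelianSchemes.AbelianSchemeQuotientDualPairDivision
import Literature.AlgebraicGeometry.AbelianSchemes.ModuleSliceOfBaseChange
import HarnessLib

/-!
# `λ_*K ≤ Stab(𝒩₁)`: sections of `Â` killed by `n` whose Poincaré class dies on every geometric fibre of `A/K` stabilise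
# `𝒩₁ = (π × 1)^*𝒫` (HECKE-LINK H2, D6 `h4` ∃-package: the input `hK′` of ★ `poincareStabilizerStructure`)

Layer `Literature/AlgebraicGeometry/AbelianSchemes`, namespace `Literature.AlgebraicGeometry.AbelianSchemes.AbelianSchemeOver`.
THEOREMS ONLY (no definition, no named fact, no instance).

Setting of ★ `AbelianSchemeQuotientPoincarePullback` ((ii) part 1): `B := A/K` (`K ⊆ A(S)` finite, free, killed by `n`), `ψ : A → B`,
`π : B → A` with `ψ ≫ π = [n]_A` (★ `quotientMk_comp_mulNDesc`), a dual pair `(Â, 𝒫)` of `A` with the unit hypothesis `hD`,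
`𝒩₁ := (π × 1)^*𝒫` on `B ×_S Â` and its STABILISER `Stab(𝒩₁) ≤ Â(S)` (★ `poincareStabilizerSubgroup`); the two-step descent of the
dual pair to `B` quotients `Â` by a finite subgroup `K′ ≤ Stab(𝒩₁)` (★ `exists_poincareStabilizerStructure … (hK′)`, ★
`dualPairOfQuotientRigidified`).  [MumfordAV1970] §15 Thm. 1: the right `K′` is `K^⊥`, the annihilator of `K` under the Weil
pairing `e_n`; on the Hecke-link line `K′ := λ_*K` for a polarisation `λ : A → Â` under which `K` is ISOTROPIC.  This file proves
the inclusion `K′ ≤ Stab(𝒩₁)` WITHOUT a scheme-level Weil pairing, from the isotropy stated FIBREWISE: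

* §1 **`nonempty_pullback_mulNDescProdSection_iso_unit_of_pow_eq_one_of_forall_fibre`** — for a section `k ∈ Â(S)` with `kⁿ = 1`
  whose class `(π × k)^*𝒫` is trivial on EVERY geometric fibre `B_s̄` (hypothesis `hfib`, the shape of ★
  `PoincarePullbackCharOfCount.section_mem_of_ncard_le`'s `hK′`: «`(1_B × k(s̄))^*𝒩₁ ≅ 𝒪`»), the class `(π × k)^*𝒫` is trivial on
  `B`: UPSTAIRS `ψ^*((π × k)^*𝒫) = ([n] × k)^*𝒫 = [n]^*𝒫_k ≅ 𝒫_{kⁿ} = 𝒫_1 ≅ 𝒪` (★ (K1) `nonempty_pullback_mulN_pullbackP_iso_unit_of_pow_eq_one`),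
  and a line bundle on `B = (A/K)_S` trivial on `A` and on every geometric fibre is trivial (★ (K4) fibrewise form
  `nonempty_iso_unit_of_pullback_quotientMk_iso_unit_of_forall_fibre`, test base `S` itself = `𝟙_ (Over S)`);
* §2 **`mem_poincareStabilizerSubgroup_of_pow_eq_one_of_forall_fibre`** — hence `k ∈ Stab(𝒩₁)` (★ (K-dict)
  `nonempty_pullback_whiskerLeft_translation_iso_iff`: stabiliser = dual kernel);
* §3 **`map_le_poincareStabilizerSubgroup (lam) (hiso)`** — for a homomorphism `λ : A → Â` and the image `λ_*K = K.map (λ ∘ –)`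
  (B-p08 (g10)'s spelling `K.map (IsMonHom.monoidHom λ (𝟙_ (Over S)))`): `λ_*K ≤ Stab(𝒩₁)` as soon as every `λ(σ)`, `σ ∈ K`, has
  trivial class on every geometric fibre of `B` (`hiso` — the isotropy «`λ(K)(s̄) ⊆ K(s̄)^⊥ = ker (π_{s̄})^∨`» of [MumfordAV1970] §23,
  stated pairing-free); `(λ σ)ⁿ = λ(σⁿ) = 1` is automatic.

Cell hodgecm-mathlib, B-plan1 (g15) 2026-08-30T00:10:10Z D6 `h4` ∃-package (lead B-p08 (g10), second hand B-p18 (g17); B-p08 GO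
00:38:40Z).  Count-neutral; HC_CM is proved only modulo the 7 printed citations until rung 0 closes — nothing here is about HC.

## References
* [MumfordAV1970] D. Mumford, *Abelian Varieties* (1970), §12 Thm. 1 (p. 112), §15 Thm. 1 (p. 143), §23 (p. 231).
* [MilneAV2008] J. S. Milne, *Abelian Varieties* (2008), I §8 (pp. 36–37), I §9 Thm. 9.1 (p. 42).
* [GortzWedhorn2020] U. Görtz, T. Wedhorn, *Algebraic Geometry I*, 2nd ed. (2020), Section (4.7) (pp. 107–108).
-/

set_option autoImplicit false

noncomputable section

-- `(A.X ⊗ T′).left = pullback A.X.hom T′.hom = (A.baseChange T′.hom).left` hold by `rfl` only.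
set_option backward.isDefEq.respectTransparency false

universe u

open CategoryTheory CategoryTheory.Limits AlgebraicGeometry MonoidalCategory CartesianMonoidalCategory
open scoped MonObj

namespace Literature.AlgebraicGeometry.AbelianSchemes.AbelianSchemeOver

open Literature.AlgebraicGeometry.RelativeSpec Literature.AlgebraicGeometry.Modules Literature.AlgebraicGeometry.Motives
  Literature.AlgebraicGeometry.AbelianVarieties

variable {S : Scheme.{u}} (A : AbelianSchemeOver S)
  {Y : Scheme.{u}} (u : S ⟶ Y) (K : Subgroup A.Sections) [IsCommMonObj A.X] {n : ℕ}
  (hK : ∀ σ : K, (σ : A.Sections) ^ n = 1)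
  [Finite K] [Y.IsSeparated] [IsSeparated (A.X.hom ≫ u)] [S.IsSeparated]
  (hcov : ∀ x : A.left, ∃ O : (A.translationActionOver u K).StableAffineOpens, x ∈ O.1)
  [LocallyOfFiniteType (A.X.hom ≫ u)] [IsLocallyNoetherian Y]
  (hG : ∃ _ : GrpObj (A.quotientOver u K), IsMonHom (A.quotientMk u K hcov))
  (hsm : Smooth (A.quotientOver u K).hom) (hgc : GeometricallyConnected (A.quotientOver u K).hom)
  (D : A.DualPair) [IsAffine Y]
  (hfree : ∀ (Ω : Type u) [Field Ω] [IsAlgClosed Ω] (x : Spec (.of Ω) ⟶ A.left) (σ : K), σ ≠ 1 →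
    x ≫ (A.translation (σ : A.Sections)).left ≠ x)

/-! ## §0 Two identities in `Over S` -/

omit [LocallyOfFiniteType (A.X.hom ≫ u)] [IsLocallyNoetherian Y] [IsAffine Y] in
/-- `(ψ ▷ 𝟙) ≫ (pr_B ≫ π, ! ≫ k) = ([n]_A ▷ 𝟙) ≫ (A ◁ k)` as morphisms `A ⊗ 𝟙 → A ⊗ Â` in `Over S` (`ψ ≫ π = [n]_A`).
[cite: MumfordAV1970, §15 Thm. 1 (p. 143)] -/
theorem whiskerRight_quotientMk_comp_lift_eq (k : D.hat.Sections) :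
    (A.quotientMk u K hcov ▷ 𝟙_ (Over S)) ≫
        lift (fst (A.quotientOver u K) (𝟙_ (Over S)) ≫ A.mulNDesc u K hK hcov) (toUnit _ ≫ k) =
      (A.mulN n ▷ 𝟙_ (Over S)) ≫ (A.X ◁ k) := by
  apply CartesianMonoidalCategory.hom_ext
  · rw [Category.assoc, lift_fst, ← Category.assoc, whiskerRight_fst, Category.assoc, quotientMk_comp_mulNDesc,
      Category.assoc, whiskerLeft_fst, whiskerRight_fst]
  · rw [Category.assoc, lift_snd, ← Category.assoc, comp_toUnit, Category.assoc, whiskerLeft_snd, ← Category.assoc,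
      whiskerRight_snd, toUnit_unique (toUnit _) (snd _ _)]

omit [IsCommMonObj A.X] [S.IsSeparated] in
/-- `(B ◁ x′) ≫ (pr_B ≫ π, ! ≫ k) = (B ◁ k(s)) ≫ (π ▷ Â)` as morphisms `B ⊗ (Spec Ω → S) → A ⊗ Â` in `Over S`, for a point
`s : Spec Ω → S` read as `x′ : (Spec Ω, s) → 𝟙`, and the restriction `k(s) = ! ≫ k` of the section `k`. [cite: MumfordAV1970, §15 Thm. 1 (p. 143)] -/
theorem whiskerLeft_comp_lift_eq {B : Over S} (p : B ⟶ A.X) (k : D.hat.Sections) {T : Over S} (x' : T ⟶ 𝟙_ (Over S)) :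
    (B ◁ x') ≫ lift (fst B (𝟙_ (Over S)) ≫ p) (toUnit _ ≫ k) = (B ◁ (toUnit T ≫ k)) ≫ (p ▷ D.hat.X) := by
  apply CartesianMonoidalCategory.hom_ext
  · rw [Category.assoc, lift_fst, ← Category.assoc, whiskerLeft_fst, Category.assoc, whiskerRight_fst, ← Category.assoc,
      whiskerLeft_fst]
  · rw [Category.assoc, lift_snd, ← Category.assoc, comp_toUnit, Category.assoc, whiskerRight_snd, whiskerLeft_snd,
      ← Category.assoc, comp_toUnit]

/-! ## §1 `(π × k)^*𝒫 ≅ 𝒪_B` from `kⁿ = 1` and fibrewise triviality -/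

include hfree in
/-- **`(π × k)^*𝒫` is trivial on `B = A/K` when `kⁿ = 1` and it is trivial on every geometric fibre of `B`.**  For `S` reduced
and locally Noetherian, the unit hypothesis `hD`, a section `k ∈ Â(S)` with `kⁿ = 1` and (`hfib`) `(1_B × k(s̄))^*𝒩₁ ≅ 𝒪` at every
geometric point `s̄` (★ `PoincarePullbackCharOfCount`'s currency; `= ((π × k)^*𝒫)|_{B_{s̄}}`): `(π × k)^*𝒫 ≅ 𝒪_B`.  Work on the
test base `S` itself (`T′ := 𝟙_ (Over S)`) with the family `M := (pr_B ≫ π, ! ≫ k)^*𝒫` on `B ⊗ 𝟙`: UPSTAIRS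
`(ψ ▷ 𝟙)^*M = ([n]_{A ⊗ 𝟙})^*(1_A × k)^*𝒫 ≅ 𝒪` (§0 + ★ (K1) `nonempty_pullback_mulN_pullbackP_iso_unit_of_pow_eq_one`, `kⁿ = 1`);
on the geometric fibres `(B ◁ x̄′)^*M = (1_B × k(s̄))^*𝒩₁ ≅ 𝒪` (§0 + `hfib`); so `M ≅ 𝒪` by ★ (K4) fibrewise
`nonempty_iso_unit_of_pullback_quotientMk_iso_unit_of_forall_fibre`, and `(π × k) = ρ_B⁻¹ ≫ (pr_B ≫ π, ! ≫ k)`.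
[cite: MumfordAV1970, §12 Thm. 1 (p. 112) and §15 Thm. 1 (p. 143)] [cite: MilneAV2008, I §8 pp. 36–37] -/
theorem nonempty_pullback_mulNDescProdSection_iso_unit_of_pow_eq_one_of_forall_fibre [IsReduced S] [IsLocallyNoetherian S]
    (hD : Nonempty ((Scheme.Modules.pullback (DualPair.unitHatSlice D)).obj D.P ≅ SheafOfModules.unit _))
    (k : D.hat.Sections) (hkn : k ^ n = 1)
    (hfib : ∀ ⦃Ω : Type u⦄ [Field Ω] [IsAlgClosed Ω] (s : Spec (.of Ω) ⟶ S),
      Nonempty ((Scheme.Modules.pullback ((A.quotientBy u K hcov hG hsm hgc).baseChangeToProd D.hat s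
          (D.hat.restrict s k).left (Over.w _))).obj
        ((Scheme.Modules.pullback ((A.mulNDesc u K hK hcov : (A.quotientBy u K hcov hG hsm hgc).X ⟶ A.X) ▷ D.hat.X).left).obj
          D.P) ≅ SheafOfModules.unit _)) :
    Nonempty ((Scheme.Modules.pullback (A.mulNDescProdSection u K hK hcov hG hsm hgc D k).left).obj D.P ≅
      SheafOfModules.unit _) := by
  -- the family `M := (pr_B ≫ π, ! ≫ k)^*𝒫` on `B ⊗ 𝟙_ (Over S)`
  let Φ : A.quotientOver u K ⊗ 𝟙_ (Over S) ⟶ A.X ⊗ D.hat.X :=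
    lift (fst (A.quotientOver u K) (𝟙_ (Over S)) ≫ A.mulNDesc u K hK hcov) (toUnit _ ≫ k)
  let M : ((A.quotientOver u K ⊗ 𝟙_ (Over S)).left).Modules := (Scheme.Modules.pullback Φ.left).obj D.P
  have hM : HasRank M 1 := hasRank_pullback _ D.hasRank_one
  -- UPSTAIRS: `(ψ ▷ 𝟙)^* M ≅ ([n]_{A_S})^* (1_A × k)^*𝒫 ≅ 𝒪` (★ (K1), `kⁿ = 1`)
  have hsq : (A.quotientMk u K hcov ▷ 𝟙_ (Over S)).left ≫ Φ.left =
      ((A.baseChange (𝟙_ (Over S)).hom).mulN n).left ≫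
        A.baseChangeToProd D.hat (𝟙_ (Over S)).hom k.left (Over.w k) := by
    rw [← Over.comp_left, A.whiskerRight_quotientMk_comp_lift_eq u K hK hcov D k, Over.comp_left,
      ← A.baseChangeHom_mulN (𝟙_ (Over S)).hom n, A.baseChangeHom_left_eq_whiskerRight_left' A (𝟙_ (Over S)) (A.mulN n),
      A.baseChangeToProd_eq_whiskerLeft_left D.hat k]
  obtain ⟨τ₀⟩ := D.nonempty_pullback_mulN_pullbackP_iso_unit_of_pow_eq_one (𝟙_ (Over S)).hom hD k n hkn
  have τ : (Scheme.Modules.pullback (A.quotientMk u K hcov ▷ 𝟙_ (Over S)).left).obj M ≅ SheafOfModules.unit _ :=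
    (Scheme.Modules.pullbackComp _ _).app D.P ≪≫ (Scheme.Modules.pullbackCongr hsq).app D.P ≪≫
      ((Scheme.Modules.pullbackComp _ _).app D.P).symm ≪≫ τ₀
  -- ON THE GEOMETRIC FIBRES: `(B ◁ x̄′)^* M = (1_B × k(s̄))^* 𝒩₁ ≅ 𝒪` (`hfib` at `s̄ := x̄ ≫ 𝟙_S`)
  have hx : ∀ ⦃Ω : Type u⦄ [Field Ω] [IsAlgClosed Ω] (x : Spec (.of Ω) ⟶ (𝟙_ (Over S)).left),
      Nonempty ((Scheme.Modules.pullback (A.quotientOver u K ◁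
        (Over.homMk x rfl : Over.mk (x ≫ (𝟙_ (Over S)).hom) ⟶ 𝟙_ (Over S))).left).obj M ≅ SheafOfModules.unit _) := by
    intro Ω _ _ x
    obtain ⟨i⟩ := hfib (x ≫ (𝟙_ (Over S)).hom)
    have hsq' : (A.quotientOver u K ◁ (Over.homMk x rfl : Over.mk (x ≫ (𝟙_ (Over S)).hom) ⟶ 𝟙_ (Over S))).left ≫ Φ.left =
        (A.quotientBy u K hcov hG hsm hgc).baseChangeToProd D.hat (x ≫ (𝟙_ (Over S)).hom)
            (D.hat.restrict (x ≫ (𝟙_ (Over S)).hom) k).left (Over.w _) ≫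
          ((A.mulNDesc u K hK hcov : (A.quotientBy u K hcov hG hsm hgc).X ⟶ A.X) ▷ D.hat.X).left := by
      have hbc := (A.quotientBy u K hcov hG hsm hgc).baseChangeToProd_eq_whiskerLeft_left D.hat
        (D.hat.restrict (x ≫ (𝟙_ (Over S)).hom) k)
      rw [← Over.comp_left, A.whiskerLeft_comp_lift_eq D (A.mulNDesc u K hK hcov) k
        (Over.homMk x rfl : Over.mk (x ≫ (𝟙_ (Over S)).hom) ⟶ 𝟙_ (Over S)), Over.comp_left]
      exact congrArg (· ≫ ((A.mulNDesc u K hK hcov : (A.quotientBy u K hcov hG hsm hgc).X ⟶ A.X) ▷ D.hat.X).left)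
        hbc.symm
    exact ⟨(Scheme.Modules.pullbackComp _ _).app D.P ≪≫ (Scheme.Modules.pullbackCongr hsq').app D.P ≪≫
      ((Scheme.Modules.pullbackComp _ _).app D.P).symm ≪≫ i⟩
  -- ★ (K4) fibrewise form on the test base `S = (𝟙_ (Over S)).left`
  haveI : IsReduced (𝟙_ (Over S)).left := inferInstanceAs (IsReduced S)
  haveI : IsLocallyNoetherian (𝟙_ (Over S)).left := inferInstanceAs (IsLocallyNoetherian S)
  obtain ⟨e⟩ := A.nonempty_iso_unit_of_pullback_quotientMk_iso_unit_of_forall_fibre (𝟙_ (Over S)) u K hcov hfree M hM τ hx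
  -- back along the unitor: `(π × k) = ρ_B⁻¹ ≫ (pr_B ≫ π, ! ≫ k)`
  have hρ : A.mulNDescProdSection u K hK hcov hG hsm hgc D k = (ρ_ (A.quotientOver u K)).inv ≫ Φ := by
    change CartesianMonoidalCategory.lift (A.mulNDesc u K hK hcov) (toUnit (A.quotientOver u K) ≫ k) = _
    apply CartesianMonoidalCategory.hom_ext
    · rw [lift_fst, Category.assoc, lift_fst, rightUnitor_inv_fst_assoc]
    · rw [lift_snd, Category.assoc, lift_snd, ← Category.assoc, comp_toUnit]
  have hρ' : (A.mulNDescProdSection u K hK hcov hG hsm hgc D k).left = (ρ_ (A.quotientOver u K)).inv.left ≫ Φ.left := by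
    rw [hρ, Over.comp_left]
  exact ⟨(Scheme.Modules.pullbackCongr hρ').app D.P ≪≫ ((Scheme.Modules.pullbackComp _ _).app D.P).symm ≪≫
    (Scheme.Modules.pullback _).mapIso e ≪≫ RigidifiedLineBundle.pullbackUnitIso _⟩

/-! ## §2 Hence `k` stabilises `𝒩₁` -/

include hfree in
/-- **A section `k ∈ Â(S)` with `kⁿ = 1` and `(1_B × k(s̄))^*𝒩₁ ≅ 𝒪` at every geometric point STABILISES `𝒩₁ = (π × 1)^*𝒫`**:
`k ∈ Stab(𝒩₁)` (§1 + ★ (K-dict) `nonempty_pullback_whiskerLeft_translation_iso_iff`: the stabiliser is the dual kernel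
«`(π × k)^*𝒫 ≅ 𝒪_B`»). [cite: MumfordAV1970, §15 Thm. 1 (p. 143)] [cite: MilneAV2008, I §9 Thm. 9.1 (p. 42)] -/
theorem mem_poincareStabilizerSubgroup_of_pow_eq_one_of_forall_fibre [IsReduced S] [IsLocallyNoetherian S]
    (hD : Nonempty ((Scheme.Modules.pullback (DualPair.unitHatSlice D)).obj D.P ≅ SheafOfModules.unit _))
    (k : D.hat.Sections) (hkn : k ^ n = 1)
    (hfib : ∀ ⦃Ω : Type u⦄ [Field Ω] [IsAlgClosed Ω] (s : Spec (.of Ω) ⟶ S),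
      Nonempty ((Scheme.Modules.pullback ((A.quotientBy u K hcov hG hsm hgc).baseChangeToProd D.hat s
          (D.hat.restrict s k).left (Over.w _))).obj
        ((Scheme.Modules.pullback ((A.mulNDesc u K hK hcov : (A.quotientBy u K hcov hG hsm hgc).X ⟶ A.X) ▷ D.hat.X).left).obj
          D.P) ≅ SheafOfModules.unit _)) :
    k ∈ A.poincareStabilizerSubgroup u K hK hcov hG hsm hgc D hfree := by
  rw [mem_poincareStabilizerSubgroup_iff, mem_poincareStabilizer_iff, poincarePullback_eq,
    A.baseChangeHom_left_eq_whiskerRight_left D (A.quotientBy u K hcov hG hsm hgc) (A.mulNDesc u K hK hcov)]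
  exact (D.nonempty_pullback_whiskerLeft_translation_iso_iff
    (A.mulNDesc u K hK hcov : (A.quotientBy u K hcov hG hsm hgc).X ⟶ A.X) k hD).2
    (A.nonempty_pullback_mulNDescProdSection_iso_unit_of_pow_eq_one_of_forall_fibre u K hK hcov hG hsm hgc D hfree hD k hkn hfib)

/-! ## §3 `λ_*K ≤ Stab(𝒩₁)` under fibrewise isotropy -/

include hfree in
/-- **`λ_*K ≤ Stab(𝒩₁)`** (the `hK′` input of ★ `poincareStabilizerStructure` / ★ `exists_poincareStabilizerStructure` for the D6 `h4`
∃-package with `K′ := λ_*K`).  For a homomorphism `λ : A → Â` (a polarisation), `S` reduced and locally Noetherian, the unit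
hypothesis `hD`, and the FIBREWISE ISOTROPY `hiso` «for `σ ∈ K`, the class `(1_B × λ(σ)(s̄))^*𝒩₁` is trivial at every geometric
point `s̄`» (= `λ(σ)(s̄) ∈ ker (π_{s̄})^∨ = K(s̄)^⊥`, [MumfordAV1970] §23 «`K` isotropic for `e^λ`», pairing-free): every
`λ(σ)`, `σ ∈ K`, stabilises `𝒩₁` — `(λ σ)ⁿ = λ(σⁿ) = λ(1) = 1` by `hK`, then §2.  Spelling of `λ_*K`: `K.map (IsMonHom.monoidHom λ 𝟙)`
(B-p08 (g10) 2026-08-30T00:25:19Z). [cite: MumfordAV1970, §15 Thm. 1 (p. 143) and §23 (p. 231)] [cite: MilneAV2008, I §9 Thm. 9.1 (p. 42)] -/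
theorem map_le_poincareStabilizerSubgroup [IsReduced S] [IsLocallyNoetherian S]
    (hD : Nonempty ((Scheme.Modules.pullback (DualPair.unitHatSlice D)).obj D.P ≅ SheafOfModules.unit _))
    (lam : A.X ⟶ D.hat.X) [IsMonHom lam]
    (hiso : ∀ (σ : K) ⦃Ω : Type u⦄ [Field Ω] [IsAlgClosed Ω] (s : Spec (.of Ω) ⟶ S),
      Nonempty ((Scheme.Modules.pullback ((A.quotientBy u K hcov hG hsm hgc).baseChangeToProd D.hat s
          (D.hat.restrict s ((σ : A.Sections) ≫ lam)).left (Over.w _))).obj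
        ((Scheme.Modules.pullback ((A.mulNDesc u K hK hcov : (A.quotientBy u K hcov hG hsm hgc).X ⟶ A.X) ▷ D.hat.X).left).obj
          D.P) ≅ SheafOfModules.unit _)) :
    K.map (IsMonHom.monoidHom lam (𝟙_ (Over S))) ≤ A.poincareStabilizerSubgroup u K hK hcov hG hsm hgc D hfree := by
  rintro k ⟨σ, hσ, rfl⟩
  have hkn : (IsMonHom.monoidHom lam (𝟙_ (Over S))) σ ^ n = 1 := by
    rw [← map_pow, hK ⟨σ, hσ⟩, map_one]
  exact A.mem_poincareStabilizerSubgroup_of_pow_eq_one_of_forall_fibre u K hK hcov hG hsm hgc D hfree hD _ hkn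
    (hiso ⟨σ, hσ⟩)

end Literature.AlgebraicGeometry.AbelianSchemes.AbelianSchemeOver

end
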